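import Summits.ResolutionOfSingularities.ResolutionOfSingularities.Theorems.FrobeniusClosingSteerCriticalThreadKey
import HarnessLib

/-!
# Steer σ-residual, LOW half — D3a (A2): the critical-surface THREAD, part 3 — the POINT / CURVE chart presentations

OURS (campaign res-hironaka, rung L ★L-G4, slot W4.1, crux `Steer` stmt-ResolutionOfSingularities-16345; res-L0-w41-plan-1
RULING 42 (A2) «run-threading» := res-L0-w41-stub-3 g6; contract = res-D-pv-012's `hthread`/`hinv` (STATUS 09:43:57Z / 10:01:51Z);
replaces the role of no printed item; NOT a statement of the manuscript under review [claim: Hironaka2017, status: under-review]; AI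
review is weaker than expert review). Theses-free, definition-free.

The two presentations of the step in the exact shapes of res-D-pv-012's `hthread` (its landed M1/M2): `pointStep_form` —
`R' = (R[𝔪/x])_{centre}` (`blowupRing`) with every non-unit of `R` divisible by `x` in `O`; `curveStep_form` — for a curve centre
`P = (e₁, e₂, w₃)` on the thread surface, `R' = (R[e₁/x, e₂/x, w₃/x])_{centre}` and every new generator is congruent to an element of
`R` modulo the non-units of `Λ` (the surface germ is unchanged). [cite: Cutkosky2014, §2.1] [folklore]
-/

noncomputable section

-- single-problem summit: the doubled namespace component `ResolutionOfSingularities` is forced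
set_option linter.dupNamespace false

namespace Summit.ResolutionOfSingularities.ResolutionOfSingularities.Theorems.SwitchingDichotomy.CriticalThread

open IsLocalRing
open Literature.AlgebraicGeometry.Resolution
open Summit.ResolutionOfSingularities.ResolutionOfSingularities.Theorems.SwitchingDichotomy

variable {K : Type} [Field K]
/-! ## §5 The two chart presentations in the shapes consumed by the LOW tower (`hthread`) -/

/-- **Point step**: when the centre is the closed point, the `x`-chart normal form reads `R' = (R[𝔪/x])_{centre}` with the
tree's `blowupRing`, and every non-unit of `R` becomes divisible by `x` in `O`. [cite: Cutkosky2014, §2.1] -/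
theorem pointStep_form {O : ValuationSubring K} {R R' : Subring K} [IsLocalRing R] {P : Ideal R}
    (hP : P = maximalIdeal R) {x : K}
    (hxmax : ∀ w : R, w ∈ P → O.valuation (w : K) ≤ O.valuation x) (hx0 : x ≠ 0)
    (hR'x : R' = locAtCentre (Subring.closure ((R : Set K) ∪ (fun w : R => (w : K) / x) '' (P : Set R))) O) :
    (∀ (w : K) (hw : w ∈ R), ¬ IsUnit (⟨w, hw⟩ : R) → w / x ∈ O) ∧ R' = locAtCentre (blowupRing R x) O := by
  subst hP
  refine ⟨fun w hw hnu => ?_, hR'x⟩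
  have hm : (⟨w, hw⟩ : R) ∈ maximalIdeal R := (IsLocalRing.mem_maximalIdeal _).mpr (mem_nonunits_iff.mpr hnu)
  have hv0 : O.valuation x ≠ 0 := by simpa using hx0
  rw [← O.valuation_le_one_iff, map_div₀, div_le_one₀ (pos_iff_ne_zero.mpr hv0)]
  exact hxmax ⟨w, hw⟩ hm

/-- **Curve step**: when the centre `P = (e₁, e₂, w₃)` is a curve on the critical surface (three generators, the first two the
thread's Jacobian pair), the `x`-chart is `R[e₁/x, e₂/x, w₃/x]` and EVERY `p/x`, `p ∈ P`, is congruent to an element of `R` modulo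
the non-units of `Λ` (`e_j/x ≡ 0`; `w₃/x ≡ γ⁻¹` where `x ≡ γ w₃ (mod (e₁, e₂))` with `γ` a unit of `R`, forced by `e_j/x ∈ 𝔪_{R'}`)
— the surface germ is unchanged (res-D-pv-012's M2 shape). [folklore] -/
theorem curveStep_form {O : ValuationSubring K} {R R' Λ : Subring K} [IsLocalRing R] [IsLocalRing R'] [IsLocalRing Λ]
    (hRO : R ≤ O.toSubring) (hval : ∀ a : R, a ∈ maximalIdeal R ↔ O.valuation (a : K) < 1)
    (hRΛ : R ≤ Λ) (hle : R ≤ R') (hle' : R' ≤ Λ)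
    {P : Ideal R} {y : Fin 3 → R} (hyP : Ideal.span (Set.range y) = P) {e₁ e₂ : R}
    (hy0 : y 0 = e₁) (hy1 : y 1 = e₂)
    {x : K} (hxR : x ∈ R) (hxP : (⟨x, hxR⟩ : R) ∈ P) (hx0 : x ≠ 0)
    (hxmax : ∀ w : R, w ∈ P → O.valuation (w : K) ≤ O.valuation x)
    (hR'x : R' = locAtCentre (Subring.closure ((R : Set K) ∪ (fun w : R => (w : K) / x) '' (P : Set R))) O)
    {E₁ E₂ : R'} (hE₁ : (E₁ : K) = (e₁ : K) / x) (hE₂ : (E₂ : K) = (e₂ : K) / x)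
    (hI1' : ∀ r' : R', r' ∈ Ideal.span {E₁, E₂} ↔ ¬ IsUnit (⟨(r' : K), hle' r'.2⟩ : Λ)) :
    ∃ S : Finset K, (↑S : Set K) ⊆ ↑O ∧
      (∀ z ∈ S, ∃ r ∈ R, ∃ hzr : z - r ∈ Λ, ¬ IsUnit (⟨z - r, hzr⟩ : Λ)) ∧
      R' = locAtCentre (Subring.closure ((R : Set K) ∪ ↑S)) O := by
  classical
  set C := Subring.closure ((R : Set K) ∪ (fun w : R => (w : K) / x) '' (P : Set R)) with hCdef
  have hCO : C ≤ O.toSubring := by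
    refine Subring.closure_le.mpr ?_
    rintro z (hz | ⟨w, hw, rfl⟩)
    · exact hRO hz
    · have hv0 : O.valuation x ≠ 0 := by simpa using hx0
      change (w : K) / x ∈ O
      rw [← O.valuation_le_one_iff, map_div₀, div_le_one₀ (pos_iff_ne_zero.mpr hv0)]
      exact hxmax w hw
  have hval' : ∀ a : R', a ∈ maximalIdeal R' ↔ O.valuation (a : K) < 1 := mem_maximalIdeal_iff_of_eq hCO hR'x
  have hCR' : C ≤ R' := chart_le_of_eq hR'x
  have hdivR' : ∀ p : R, p ∈ P → (p : K) / x ∈ R' := fun p hp => hCR' (Subring.subset_closure (Or.inr ⟨p, hp, rfl⟩))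
  -- `E_j` are non-units of `Λ` and of `R'`
  have hE₁Λ : ¬ IsUnit (⟨(E₁ : K), hle' E₁.2⟩ : Λ) := (hI1' E₁).mp (Ideal.subset_span (Set.mem_insert _ _))
  have hE₂Λ : ¬ IsUnit (⟨(E₂ : K), hle' E₂.2⟩ : Λ) :=
    (hI1' E₂).mp (Ideal.subset_span (Set.mem_insert_of_mem _ (Set.mem_singleton _)))
  have hunitΛ : ∀ {t : R'}, IsUnit t → IsUnit (⟨(t : K), hle' t.2⟩ : Λ) := fun {t} ht => ht.map (Subring.inclusion hle')
  have hE₁m : E₁ ∈ maximalIdeal R' :=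
    (IsLocalRing.mem_maximalIdeal _).mpr (mem_nonunits_iff.mpr fun h => hE₁Λ (hunitΛ h))
  have hE₂m : E₂ ∈ maximalIdeal R' :=
    (IsLocalRing.mem_maximalIdeal _).mpr (mem_nonunits_iff.mpr fun h => hE₂Λ (hunitΛ h))
  rw [← mem_nonunits_iff, ← IsLocalRing.mem_maximalIdeal] at hE₁Λ hE₂Λ
  have he₁x : (e₁ : K) = (E₁ : K) * x := by rw [hE₁, div_mul_cancel₀ _ hx0]
  have he₂x : (e₂ : K) = (E₂ : K) * x := by rw [hE₂, div_mul_cancel₀ _ hx0]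
  -- `x = c₀ e₁ + c₁ e₂ + c₂ w₃`, and `c₂` is a unit of `R`
  have hxP' : (⟨x, hxR⟩ : R) ∈ Ideal.span (Set.range y) := by rw [hyP]; exact hxP
  obtain ⟨c, hc⟩ := Ideal.mem_span_range_iff_exists_fun.mp hxP'
  rw [Fin.sum_univ_three, hy0, hy1] at hc
  have hcK : (c 0 : K) * e₁ + (c 1 : K) * e₂ + (c 2 : K) * (y 2 : R) = x := by
    have := congrArg Subtype.val hc; simpa using this
  have hw₃x : ((y 2 : R) : K) / x ∈ R' := hdivR' (y 2) (hyP ▸ Ideal.subset_span ⟨2, rfl⟩)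
  have hone : (1 : R') = ⟨(c 0 : K), hle (c 0).2⟩ * E₁ + ⟨(c 1 : K), hle (c 1).2⟩ * E₂ +
      ⟨(c 2 : K), hle (c 2).2⟩ * ⟨((y 2 : R) : K) / x, hw₃x⟩ := by
    apply Subtype.ext
    push_cast
    rw [hE₁, hE₂, mul_div_assoc', mul_div_assoc', mul_div_assoc', ← add_div, ← add_div, eq_div_iff hx0, one_mul]
    exact hcK.symm
  have hc2u : IsUnit (c 2) := by
    by_contra hnu
    have hm : c 2 ∈ maximalIdeal R := (IsLocalRing.mem_maximalIdeal _).mpr (mem_nonunits_iff.mpr hnu)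
    have hm' : (⟨(c 2 : K), hle (c 2).2⟩ : R') ∈ maximalIdeal R' := (hval' _).mpr ((hval _).mp hm)
    have h1 : (1 : R') ∈ maximalIdeal R' := by
      rw [hone]
      exact Ideal.add_mem _ (Ideal.add_mem _ (Ideal.mul_mem_left _ _ hE₁m) (Ideal.mul_mem_left _ _ hE₂m))
        (Ideal.mul_mem_right _ _ hm')
    exact (maximalIdeal.isMaximal R').ne_top ((Ideal.eq_top_iff_one _).mpr h1)
  obtain ⟨hc20, hc2inv⟩ := (isUnit_subring_iff_inv_mem _).mp hc2u
  have honeK : (1 : K) = (c 0 : K) * E₁ + (c 1 : K) * E₂ + (c 2 : K) * (((y 2 : R) : K) / x) := by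
    have := congrArg Subtype.val hone; simpa using this
  -- `w₃ / x = c₂⁻¹ (1 − c₀ E₁ − c₁ E₂)`
  have hw : ((y 2 : R) : K) / x = ((c 2 : R) : K)⁻¹ * (1 - (c 0 : K) * E₁ - (c 1 : K) * E₂) := by
    rw [eq_inv_mul_iff_mul_eq₀ hc20]
    linear_combination -honeK
  have hy₂ : ((y 2 : R) : K) = x * (((c 2 : R) : K)⁻¹ * (1 - (c 0 : K) * E₁ - (c 1 : K) * E₂)) := by
    rw [← hw, mul_div_cancel₀ _ hx0]
  -- the residue of `p / x`, `p ∈ P`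
  have hres : ∀ p : R, p ∈ P → ∃ r ∈ R, ∃ hzr : (p : K) / x - r ∈ Λ, ¬ IsUnit (⟨(p : K) / x - r, hzr⟩ : Λ) := by
    intro p hp
    have hp' : p ∈ Ideal.span (Set.range y) := by rw [hyP]; exact hp
    obtain ⟨a, ha⟩ := Ideal.mem_span_range_iff_exists_fun.mp hp'
    rw [Fin.sum_univ_three, hy0, hy1] at ha
    have haK : (a 0 : K) * e₁ + (a 1 : K) * e₂ + (a 2 : K) * (y 2 : R) = p := by
      have := congrArg Subtype.val ha; simpa using this
    have hrR : (a 2 : K) * ((c 2 : R) : K)⁻¹ ∈ R := R.mul_mem (a 2).2 hc2inv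
    refine ⟨(a 2 : K) * ((c 2 : R) : K)⁻¹, hrR, Λ.sub_mem (hle' (hdivR' p hp)) (hRΛ hrR), ?_⟩
    rw [← mem_nonunits_iff, ← IsLocalRing.mem_maximalIdeal]
    have hval_eq : (p : K) / x - (a 2 : K) * ((c 2 : R) : K)⁻¹ =
        ((a 0 : K) - (a 2 : K) * ((c 2 : R) : K)⁻¹ * (c 0 : K)) * E₁ +
          ((a 1 : K) - (a 2 : K) * ((c 2 : R) : K)⁻¹ * (c 1 : K)) * E₂ := by
      rw [← haK, he₁x, he₂x, hy₂]
      field_simp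
      ring
    have heq : (⟨(p : K) / x - (a 2 : K) * ((c 2 : R) : K)⁻¹, Λ.sub_mem (hle' (hdivR' p hp)) (hRΛ hrR)⟩ : Λ) =
        ⟨(a 0 : K) - (a 2 : K) * ((c 2 : R) : K)⁻¹ * (c 0 : K),
            Λ.sub_mem (hRΛ (a 0).2) (Λ.mul_mem (hRΛ hrR) (hRΛ (c 0).2))⟩ * ⟨(E₁ : K), hle' E₁.2⟩ +
          ⟨(a 1 : K) - (a 2 : K) * ((c 2 : R) : K)⁻¹ * (c 1 : K),
            Λ.sub_mem (hRΛ (a 1).2) (Λ.mul_mem (hRΛ hrR) (hRΛ (c 1).2))⟩ * ⟨(E₂ : K), hle' E₂.2⟩ :=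
      Subtype.ext hval_eq
    rw [heq]
    exact Ideal.add_mem _ (Ideal.mul_mem_left _ _ hE₁Λ) (Ideal.mul_mem_left _ _ hE₂Λ)
  -- the new generators
  let S : Finset K := Finset.univ.image fun j : Fin 3 => ((y j : R) : K) / x
  have hS : (↑S : Set K) = (fun w : R => (w : K) / x) '' Set.range y := by
    rw [Finset.coe_image, Finset.coe_univ, Set.image_univ, ← Set.range_comp]
    rfl
  refine ⟨S, ?_, ?_, ?_⟩
  · -- `S ⊆ O`
    rw [hS]
    rintro _ ⟨w, ⟨j, rfl⟩, rfl⟩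
    exact hCO (Subring.subset_closure (Or.inr ⟨y j, hyP ▸ Ideal.subset_span ⟨j, rfl⟩, rfl⟩))
  · -- residues
    intro z hz
    rw [← Finset.mem_coe, hS] at hz
    obtain ⟨w, ⟨j, rfl⟩, rfl⟩ := hz
    exact hres (y j) (hyP ▸ Ideal.subset_span ⟨j, rfl⟩)
  · -- the chart
    rw [hR'x, hCdef, SteeredRun.closure_union_image_div_eq_of_span_eq R x (Set.range y) hyP, hS]

end Summit.ResolutionOfSingularities.ResolutionOfSingularities.Theorems.SwitchingDichotomy.CriticalThread

end
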